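import Mathlib
import HarnessLib
import Summits.HubbardSuperconductivity.HubbardSuperconductivity.Theorems.ComplexGFFStiffnessHypALocalTwoPointFormChangeOfSeed
import Summits.HubbardSuperconductivity.HubbardSuperconductivity.Theorems.ComplexGFFStiffnessHypALocalTwoPointLogCalculus

/-!
# Crux `HypALocalTwoPoint`, line `gnv` — the three pieces of the free energy
# `f = log κ_{𝟙,𝟙+q(ℋ⋆)} + |Λ|·λ(ℋ⋆) + Log I`: first and second differences from those of `ℋ⋆` and `I`

Route `route-HubbardSuperconductivity-ComplexGFFStiffness`, crux item stmt-HubbardSuperconductivity-19155,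
registered stub `stub_twoPointGivenZ`, census F1 of the memo FREEENERGY-PLAN-cgffstiff2-g1 §3.  By the tuned
representation ([ABKM19] (4.7)–(4.12), tree: `pertZ_eq_mul_integral_flowStart_q`),
`pertZ n 𝒦 = Z₀ · κ_{𝟙,𝟙+q(ℋ⋆)} · e^{|Λ|λ(ℋ⋆)} · I(𝒦)` with `ℋ⋆ = ℋ⋆(𝒦)` the tuned seed, `λ(ℋ) = ℋ(∅-index)`
its constant coefficient and `I` the last-scale integral; hence `pertZ = Z₀·exp(f)` with
`f(𝒦) = log κ_{𝟙,𝟙+q(ℋ⋆(𝒦))} + |Λ|·λ(ℋ⋆(𝒦)) + Log I(𝒦)`.  This file isolates the purely algebraic step of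
the assembly: the first and mixed second differences of `f` over perturbations `𝒦_{ij}` are bounded by
those of the SEEDS `h_{ij} = ℋ⋆(𝒦_{ij})` (which the fixed-point theorems
`RGFlow.norm_initial_sub_le_of_isTunedQ` / `RGFlow.secondDiff_initial_le_of_isTunedQ` control) and of the
INTEGRALS `I_{ij}` (controlled by the trajectory clauses of the same theorems and the last-scale
estimate), through `…FormChangeOfSeed` (κ-part, `|Λ|c`, `2|Λ|c²`), the constant coefficient
(`|λ(h)| ≤ ‖h‖`, linear) and `…LogCalculus` (Log-part, `1/(1−R)`, `1/(1−R)²`):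

* `norm_constCoeff_le_norm`, `constCoeff_sub`;
* **`norm_freeEnergyPiece_sub_le`** (first differences), **`norm_secondDiff_freeEnergyPiece_le`** (four
  arbitrary seeds / integrals — quadrilateral form).

All proved, no `sorry`; the objects `ℋ⋆`, `I` themselves are not constructed here.

## References
* S. Adams, S. Buchholz, R. Kotecký, S. Müller, arXiv:1910.13564, Ch. 4.2 (4.7)–(4.12), Theorem 2.2
  [AdamsBuchholzKoteckyMuller2019].
-/

noncomputable section

-- `Summit.<Summit>.<Problem>`: single-conjunct summit, the duplicate component is mandated (D-0017).
set_option linter.dupNamespace false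

namespace Summit.HubbardSuperconductivity.HubbardSuperconductivity.Theorems.ComplexGFF

open scoped BigOperators Matrix
open Finset Matrix
open Literature.MathematicalPhysics.StatisticalMechanics.GradientRG

variable {d M : ℕ} [NeZero M] {𝔥 R : ℝ} {n : ℕ} [Fact (0 < 𝔥)] [Fact (0 < R)] [Fact (0 < n)]

omit [NeZero M] in
/-- The constant coefficient is bounded by the coefficient norm: `‖λ(h)‖ ≤ ‖h‖` (`n ≥ 1`). -/
theorem norm_constCoeff_le_norm (h : HamSpace ℂ d 𝔥 R n) : ‖(HamSpace.toHam h) (Sum.inl ())‖ ≤ ‖h‖ := by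
  have h𝔥 : 0 < 𝔥 := Fact.out
  have hR : 0 < R := Fact.out
  have hn : 0 < n := Fact.out
  rw [HamSpace.norm_def]
  unfold hamNorm
  have hn1 : (1 : ℝ) ≤ n := by exact_mod_cast hn
  have hs1 : 0 ≤ ∑ α : linIndex d, 𝔥 * (R ^ (∑ i, (α : Fin d → ℕ) i))⁻¹ * ‖(HamSpace.toHam h) (Sum.inr (Sum.inl α))‖ :=
    Finset.sum_nonneg fun α _ => by positivity
  have hs2 : 0 ≤ ∑ q : quadIndex d, (𝔥 / R) ^ 2 * ‖(HamSpace.toHam h) (Sum.inr (Sum.inr q))‖ :=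
    Finset.sum_nonneg fun q _ => by positivity
  have h0 : 0 ≤ ‖(HamSpace.toHam h) (Sum.inl ())‖ := norm_nonneg _
  nlinarith

omit [NeZero M] [Fact (0 < 𝔥)] [Fact (0 < R)] [Fact (0 < n)] in
/-- The constant coefficient is linear: differences. -/
theorem constCoeff_sub (h h' : HamSpace ℂ d 𝔥 R n) :
    (HamSpace.toHam h) (Sum.inl ()) - (HamSpace.toHam h') (Sum.inl ()) = (HamSpace.toHam (h - h')) (Sum.inl ()) := by
  rw [map_sub]; rfl

/-- **First differences of the free-energy pieces**: for seeds in the ball `c‖·‖ ≤ ½` (`c = 2d²/(n(𝔥/R)²)`)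
and integrals with `‖I − 1‖ ≤ R₀ < 1`:
`‖f(h₁,I₁) − f(h₂,I₂)‖ ≤ |Λ|·c·‖h₁ − h₂‖ + |Λ|·‖h₁ − h₂‖ + ‖I₁ − I₂‖/(1−R₀)`. -/
theorem norm_freeEnergyPiece_sub_le {R₀ : ℝ} (hR₀ : R₀ < 1) (h₁ h₂ : HamSpace ℂ d 𝔥 R n) (I₁ I₂ : ℂ)
    (hh₁ : 2 * (d : ℝ) ^ 2 / ((n : ℝ) * (𝔥 / R) ^ 2) * ‖h₁‖ ≤ 1 / 2)
    (hh₂ : 2 * (d : ℝ) ^ 2 / ((n : ℝ) * (𝔥 / R) ^ 2) * ‖h₂‖ ≤ 1 / 2)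
    (hI₁ : ‖I₁ - 1‖ ≤ R₀) (hI₂ : ‖I₂ - 1‖ ≤ R₀) :
    ‖((((Real.log (formChangeConst (M := M) (1 : Matrix (Fin d) (Fin d) ℝ) (1 + hamQuadForm (HamSpace.toHam h₁)))) : ℝ) : ℂ)
          + (Fintype.card (Fin d → ZMod M) : ℂ) * (HamSpace.toHam h₁) (Sum.inl ()) + Complex.log I₁) - ((((Real.log (formChangeConst (M := M) (1 : Matrix (Fin d) (Fin d) ℝ) (1 + hamQuadForm (HamSpace.toHam h₂)))) : ℝ) : ℂ)
          + (Fintype.card (Fin d → ZMod M) : ℂ) * (HamSpace.toHam h₂) (Sum.inl ()) + Complex.log I₂)‖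
      ≤ (Fintype.card (Fin d → ZMod M) : ℝ) * (2 * (d : ℝ) ^ 2 / ((n : ℝ) * (𝔥 / R) ^ 2) * ‖h₁ - h₂‖)
        + (Fintype.card (Fin d → ZMod M) : ℝ) * ‖h₁ - h₂‖ + 1 / (1 - R₀) * ‖I₁ - I₂‖ := by
  set V : ℝ := (Fintype.card (Fin d → ZMod M) : ℝ) with hV
  have hV0 : 0 ≤ V := by positivity
  -- κ-part
  have hκ := abs_log_formChangeConst_seed_sub_le (M := M) h₁ h₂ hh₁ hh₂
  -- λ-part
  have hlam : ‖(V : ℂ) * (HamSpace.toHam h₁) (Sum.inl ()) - (V : ℂ) * (HamSpace.toHam h₂) (Sum.inl ())‖ ≤ V * ‖h₁ - h₂‖ := by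
    rw [← mul_sub, norm_mul, Complex.norm_real, Real.norm_eq_abs, abs_of_nonneg hV0, constCoeff_sub]
    exact mul_le_mul_of_nonneg_left (norm_constCoeff_le_norm _) hV0
  -- Log-part
  have hL : ‖Complex.log I₁ - Complex.log I₂‖ ≤ 1 / (1 - R₀) * ‖I₁ - I₂‖ := by
    have h := norm_log_one_add_sub_le hR₀ (u := I₁ - 1) (u' := I₂ - 1) hI₁ hI₂
    simp only [add_sub_cancel] at h
    have e : I₁ - 1 - (I₂ - 1) = I₁ - I₂ := by ring
    rw [e] at h
    exact h
  have e : ((((Real.log (formChangeConst (M := M) (1 : Matrix (Fin d) (Fin d) ℝ) (1 + hamQuadForm (HamSpace.toHam h₁)))) : ℝ) : ℂ)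
          + (Fintype.card (Fin d → ZMod M) : ℂ) * (HamSpace.toHam h₁) (Sum.inl ()) + Complex.log I₁) - ((((Real.log (formChangeConst (M := M) (1 : Matrix (Fin d) (Fin d) ℝ) (1 + hamQuadForm (HamSpace.toHam h₂)))) : ℝ) : ℂ)
          + (Fintype.card (Fin d → ZMod M) : ℂ) * (HamSpace.toHam h₂) (Sum.inl ()) + Complex.log I₂)
      = (((Real.log (formChangeConst (M := M) (1 : Matrix (Fin d) (Fin d) ℝ) (1 + hamQuadForm (HamSpace.toHam h₁))) : ℝ) : ℂ)
          - ((Real.log (formChangeConst (M := M) (1 : Matrix (Fin d) (Fin d) ℝ) (1 + hamQuadForm (HamSpace.toHam h₂))) : ℝ) : ℂ))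
        + (((V : ℂ) * (HamSpace.toHam h₁) (Sum.inl ()) - (V : ℂ) * (HamSpace.toHam h₂) (Sum.inl ())))
        + (Complex.log I₁ - Complex.log I₂) := by
    rw [hV]; push_cast; ring
  rw [e]
  refine (norm_add_le _ _).trans (add_le_add ((norm_add_le _ _).trans (add_le_add ?_ hlam)) hL)
  rw [← Complex.ofReal_sub, Complex.norm_real, Real.norm_eq_abs]
  exact hκ

/-- **Mixed second differences of the free-energy pieces over four (seed, integral) pairs** (no
parallelogram structure assumed): with `c = 2d²/(n(𝔥/R)²)`, seeds `h₀₀, h₁₀, h₀₁` in the ball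
`c‖·‖ ≤ 1/6` and `h₁₁` in `c‖·‖ ≤ ½`, integrals with `‖I − 1‖ ≤ R₀/3` (three) and `≤ R₀` (`R₀ < 1`):
`‖Σ± f‖ ≤ |Λ|c‖Σ±h‖ + 2|Λ|c²‖h₁₀−h₀₀‖‖h₀₁−h₀₀‖ + |Λ|‖Σ±h‖ + ‖Σ±I‖/(1−R₀) + ‖I₁₀−I₀₀‖‖I₀₁−I₀₀‖/(1−R₀)²`. -/
theorem norm_secondDiff_freeEnergyPiece_le {R₀ : ℝ} (hR₀ : R₀ < 1)
    (h₀₀ h₁₀ h₀₁ h₁₁ : HamSpace ℂ d 𝔥 R n) (I₀₀ I₁₀ I₀₁ I₁₁ : ℂ)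
    (hh₀₀ : 2 * (d : ℝ) ^ 2 / ((n : ℝ) * (𝔥 / R) ^ 2) * ‖h₀₀‖ ≤ 1 / 6)
    (hh₁₀ : 2 * (d : ℝ) ^ 2 / ((n : ℝ) * (𝔥 / R) ^ 2) * ‖h₁₀‖ ≤ 1 / 6)
    (hh₀₁ : 2 * (d : ℝ) ^ 2 / ((n : ℝ) * (𝔥 / R) ^ 2) * ‖h₀₁‖ ≤ 1 / 6)
    (hh₁₁ : 2 * (d : ℝ) ^ 2 / ((n : ℝ) * (𝔥 / R) ^ 2) * ‖h₁₁‖ ≤ 1 / 2)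
    (hI₀₀ : ‖I₀₀ - 1‖ ≤ R₀ / 3) (hI₁₀ : ‖I₁₀ - 1‖ ≤ R₀ / 3) (hI₀₁ : ‖I₀₁ - 1‖ ≤ R₀ / 3) (hI₁₁ : ‖I₁₁ - 1‖ ≤ R₀) :
    ‖((((Real.log (formChangeConst (M := M) (1 : Matrix (Fin d) (Fin d) ℝ) (1 + hamQuadForm (HamSpace.toHam h₁₁)))) : ℝ) : ℂ)
          + (Fintype.card (Fin d → ZMod M) : ℂ) * (HamSpace.toHam h₁₁) (Sum.inl ()) + Complex.log I₁₁) - ((((Real.log (formChangeConst (M := M) (1 : Matrix (Fin d) (Fin d) ℝ) (1 + hamQuadForm (HamSpace.toHam h₁₀)))) : ℝ) : ℂ)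
          + (Fintype.card (Fin d → ZMod M) : ℂ) * (HamSpace.toHam h₁₀) (Sum.inl ()) + Complex.log I₁₀) - ((((Real.log (formChangeConst (M := M) (1 : Matrix (Fin d) (Fin d) ℝ) (1 + hamQuadForm (HamSpace.toHam h₀₁)))) : ℝ) : ℂ)
          + (Fintype.card (Fin d → ZMod M) : ℂ) * (HamSpace.toHam h₀₁) (Sum.inl ()) + Complex.log I₀₁)
        + ((((Real.log (formChangeConst (M := M) (1 : Matrix (Fin d) (Fin d) ℝ) (1 + hamQuadForm (HamSpace.toHam h₀₀)))) : ℝ) : ℂ)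
          + (Fintype.card (Fin d → ZMod M) : ℂ) * (HamSpace.toHam h₀₀) (Sum.inl ()) + Complex.log I₀₀)‖
      ≤ (Fintype.card (Fin d → ZMod M) : ℝ) * (2 * (d : ℝ) ^ 2 / ((n : ℝ) * (𝔥 / R) ^ 2)) * ‖h₁₁ - h₁₀ - h₀₁ + h₀₀‖
        + 2 * (Fintype.card (Fin d → ZMod M) : ℝ) * (2 * (d : ℝ) ^ 2 / ((n : ℝ) * (𝔥 / R) ^ 2)) ^ 2
            * ‖h₁₀ - h₀₀‖ * ‖h₀₁ - h₀₀‖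
        + (Fintype.card (Fin d → ZMod M) : ℝ) * ‖h₁₁ - h₁₀ - h₀₁ + h₀₀‖
        + 1 / (1 - R₀) * ‖I₁₁ - I₁₀ - I₀₁ + I₀₀‖ + 1 / (1 - R₀) ^ 2 * ‖I₁₀ - I₀₀‖ * ‖I₀₁ - I₀₀‖ := by
  set V : ℝ := (Fintype.card (Fin d → ZMod M) : ℝ) with hV
  have hV0 : 0 ≤ V := by positivity
  -- κ-part
  have hκ := abs_secondDiff_log_formChangeConst_seed_quad_le (M := M) hh₀₀ hh₁₀ hh₀₁ hh₁₁
  -- λ-part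
  have hlam : ‖(V : ℂ) * (HamSpace.toHam h₁₁) (Sum.inl ()) - (V : ℂ) * (HamSpace.toHam h₁₀) (Sum.inl ())
        - (V : ℂ) * (HamSpace.toHam h₀₁) (Sum.inl ()) + (V : ℂ) * (HamSpace.toHam h₀₀) (Sum.inl ())‖
      ≤ V * ‖h₁₁ - h₁₀ - h₀₁ + h₀₀‖ := by
    have e : (V : ℂ) * (HamSpace.toHam h₁₁) (Sum.inl ()) - (V : ℂ) * (HamSpace.toHam h₁₀) (Sum.inl ())
        - (V : ℂ) * (HamSpace.toHam h₀₁) (Sum.inl ()) + (V : ℂ) * (HamSpace.toHam h₀₀) (Sum.inl ())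
        = (V : ℂ) * (HamSpace.toHam (h₁₁ - h₁₀ - h₀₁ + h₀₀)) (Sum.inl ()) := by
      rw [map_add, map_sub, map_sub]
      simp only [Pi.add_apply, Pi.sub_apply]
      ring
    rw [e, norm_mul, Complex.norm_real, Real.norm_eq_abs, abs_of_nonneg hV0]
    exact mul_le_mul_of_nonneg_left (norm_constCoeff_le_norm _) hV0
  -- Log-part
  have hL : ‖Complex.log I₁₁ - Complex.log I₁₀ - Complex.log I₀₁ + Complex.log I₀₀‖
      ≤ 1 / (1 - R₀) * ‖I₁₁ - I₁₀ - I₀₁ + I₀₀‖ + 1 / (1 - R₀) ^ 2 * ‖I₁₀ - I₀₀‖ * ‖I₀₁ - I₀₀‖ := by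
    have h := norm_secondDiff_log_one_add_quad_le hR₀ (a₀₀ := I₀₀ - 1) (a₁₀ := I₁₀ - 1) (a₀₁ := I₀₁ - 1)
      (a₁₁ := I₁₁ - 1) hI₀₀ hI₁₀ hI₀₁ hI₁₁
    simp only [add_sub_cancel] at h
    have e1 : I₁₁ - 1 - (I₁₀ - 1) - (I₀₁ - 1) + (I₀₀ - 1) = I₁₁ - I₁₀ - I₀₁ + I₀₀ := by ring
    have e2 : I₁₀ - 1 - (I₀₀ - 1) = I₁₀ - I₀₀ := by ring
    have e3 : I₀₁ - 1 - (I₀₀ - 1) = I₀₁ - I₀₀ := by ring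
    rw [e1, e2, e3] at h
    exact h
  have e : ((((Real.log (formChangeConst (M := M) (1 : Matrix (Fin d) (Fin d) ℝ) (1 + hamQuadForm (HamSpace.toHam h₁₁)))) : ℝ) : ℂ)
          + (Fintype.card (Fin d → ZMod M) : ℂ) * (HamSpace.toHam h₁₁) (Sum.inl ()) + Complex.log I₁₁) - ((((Real.log (formChangeConst (M := M) (1 : Matrix (Fin d) (Fin d) ℝ) (1 + hamQuadForm (HamSpace.toHam h₁₀)))) : ℝ) : ℂ)
          + (Fintype.card (Fin d → ZMod M) : ℂ) * (HamSpace.toHam h₁₀) (Sum.inl ()) + Complex.log I₁₀) - ((((Real.log (formChangeConst (M := M) (1 : Matrix (Fin d) (Fin d) ℝ) (1 + hamQuadForm (HamSpace.toHam h₀₁)))) : ℝ) : ℂ)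
          + (Fintype.card (Fin d → ZMod M) : ℂ) * (HamSpace.toHam h₀₁) (Sum.inl ()) + Complex.log I₀₁)
        + ((((Real.log (formChangeConst (M := M) (1 : Matrix (Fin d) (Fin d) ℝ) (1 + hamQuadForm (HamSpace.toHam h₀₀)))) : ℝ) : ℂ)
          + (Fintype.card (Fin d → ZMod M) : ℂ) * (HamSpace.toHam h₀₀) (Sum.inl ()) + Complex.log I₀₀)
      = (((Real.log (formChangeConst (M := M) (1 : Matrix (Fin d) (Fin d) ℝ) (1 + hamQuadForm (HamSpace.toHam h₁₁)))
            - Real.log (formChangeConst (M := M) (1 : Matrix (Fin d) (Fin d) ℝ) (1 + hamQuadForm (HamSpace.toHam h₁₀)))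
            - Real.log (formChangeConst (M := M) (1 : Matrix (Fin d) (Fin d) ℝ) (1 + hamQuadForm (HamSpace.toHam h₀₁)))
            + Real.log (formChangeConst (M := M) (1 : Matrix (Fin d) (Fin d) ℝ) (1 + hamQuadForm (HamSpace.toHam h₀₀))) : ℝ) : ℂ))
        + ((V : ℂ) * (HamSpace.toHam h₁₁) (Sum.inl ()) - (V : ℂ) * (HamSpace.toHam h₁₀) (Sum.inl ())
            - (V : ℂ) * (HamSpace.toHam h₀₁) (Sum.inl ()) + (V : ℂ) * (HamSpace.toHam h₀₀) (Sum.inl ()))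
        + (Complex.log I₁₁ - Complex.log I₁₀ - Complex.log I₀₁ + Complex.log I₀₀) := by
    rw [hV]; push_cast; ring
  rw [e]
  have hκ' : ‖(((Real.log (formChangeConst (M := M) (1 : Matrix (Fin d) (Fin d) ℝ) (1 + hamQuadForm (HamSpace.toHam h₁₁)))
            - Real.log (formChangeConst (M := M) (1 : Matrix (Fin d) (Fin d) ℝ) (1 + hamQuadForm (HamSpace.toHam h₁₀)))
            - Real.log (formChangeConst (M := M) (1 : Matrix (Fin d) (Fin d) ℝ) (1 + hamQuadForm (HamSpace.toHam h₀₁)))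
            + Real.log (formChangeConst (M := M) (1 : Matrix (Fin d) (Fin d) ℝ) (1 + hamQuadForm (HamSpace.toHam h₀₀))) : ℝ) : ℂ))‖
      ≤ V * (2 * (d : ℝ) ^ 2 / ((n : ℝ) * (𝔥 / R) ^ 2)) * ‖h₁₁ - h₁₀ - h₀₁ + h₀₀‖
        + 2 * V * (2 * (d : ℝ) ^ 2 / ((n : ℝ) * (𝔥 / R) ^ 2)) ^ 2 * ‖h₁₀ - h₀₀‖ * ‖h₀₁ - h₀₀‖ := by
    rw [Complex.norm_real, Real.norm_eq_abs]; exact hκ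
  calc _ ≤ ‖(((Real.log (formChangeConst (M := M) (1 : Matrix (Fin d) (Fin d) ℝ) (1 + hamQuadForm (HamSpace.toHam h₁₁)))
            - Real.log (formChangeConst (M := M) (1 : Matrix (Fin d) (Fin d) ℝ) (1 + hamQuadForm (HamSpace.toHam h₁₀)))
            - Real.log (formChangeConst (M := M) (1 : Matrix (Fin d) (Fin d) ℝ) (1 + hamQuadForm (HamSpace.toHam h₀₁)))
            + Real.log (formChangeConst (M := M) (1 : Matrix (Fin d) (Fin d) ℝ) (1 + hamQuadForm (HamSpace.toHam h₀₀))) : ℝ) : ℂ))‖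
        + ‖(V : ℂ) * (HamSpace.toHam h₁₁) (Sum.inl ()) - (V : ℂ) * (HamSpace.toHam h₁₀) (Sum.inl ())
            - (V : ℂ) * (HamSpace.toHam h₀₁) (Sum.inl ()) + (V : ℂ) * (HamSpace.toHam h₀₀) (Sum.inl ())‖
        + ‖Complex.log I₁₁ - Complex.log I₁₀ - Complex.log I₀₁ + Complex.log I₀₀‖ :=
        (norm_add_le _ _).trans (add_le_add (norm_add_le _ _) le_rfl)
    _ ≤ _ := by linarith [hκ', hlam, hL]

end Summit.HubbardSuperconductivity.HubbardSuperconductivity.Theorems.ComplexGFF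

end
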